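import Summits.HubbardSuperconductivity.HubbardSuperconductivity.Theorems.NodalDiracTwistNodalDiracWeakCouplingMoebiusModel
import Literature.MathematicalPhysics.QuantumLattice.FockRelabel
import Literature.MathematicalPhysics.QuantumLattice.FockMapOpLiebW
import Literature.MathematicalPhysics.QuantumLattice.HubbardWave0PosSemidefProofs
import HarnessLib

/-!
# Route `LiebTwin`, support `RealFlipDefiniteSuffices` (item `stmt-HubbardSuperconductivity-15658`):
# the spin flip in Lieb's coordinates (helper file, `--supports`)

Tools for `Theorems/LiebTwinRealFlipDefiniteSuffices.lean` (Lieb's "W Hermitian WLOG" step as an order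
statement), on a general finite ordered site set `Λ`, for the spin-flip unitary
`F = fockRelabel Orb.spinSwap` (the real signed-permutation matrix of the orbital bijection
`(x, σ) ↦ (x, 1-σ)`, tree `FockRelabel.lean`):

* THE SIGN IDENTITY `W(F χ) = (-1)^{n²} W(χ)ᵀ` (`liebW_fockRelabel_spinSwap_mulVec`): on Lieb's coefficient
  matrices `W = liebW n χ` of the `(n, n)` sector the spin exchange is the TRANSPOSE up to the uniform
  sign `ε_F(α↑ ∪ β↓) σ(α,β) σ(β,α) = (-1)^{|α||β|}` (`relabelSign_spinSwap_pairSet_mul`: the relabelling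
  sign of the spin exchange counts the doubly occupied sites, Lieb's two Jordan–Wigner signs count the
  off-diagonal pairs; four-block split of the pair-weight product as in the tree's
  `relabelSign_mapEquiv_pairSet`);
* `F` is real (`star_fockRelabel_spinSwap_mulVec`, from the tree's `fockRelabel_map_star`) and an involution
  (`fockRelabel_spinSwap_mulVec_mulVec`, from the tree's `fockRelabel_spinSwap_mul_self`);
* additivity of `F`-invariant quadratic forms and of the norm over the `±1` eigenvectors of `F`
  (`expect_add_of_flip`, `star_add_dotProduct_add_of_flip`), and of real quadratic forms `‖Δ ·‖²` and the
  norm over real and imaginary parts (`expect_conjTranspose_mul_add_I_smul`, `star_add_I_smul_dotProduct`).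

Sources: E. H. Lieb, PRL **62** (1989) 1201, proof of Theorem 1 ("the Hamiltonian is symmetric between
the up and the down spins"; "we can assume `W` Hermitian"); H. Tasaki, *Physics and Mathematics of
Quantum Many-Body Systems* (2020), §9.2.1 (Jordan–Wigner signs); O. Bratteli, D. W. Robinson, *Operator
Algebras and Quantum Statistical Mechanics II* (1997), Thm. 5.2.5 (second quantisation of one-particle
permutations). No definition and no named fact is introduced.
-/

-- the mandated namespace `Summit.<Summit>.<Problem>.Theorems` repeats `HubbardSuperconductivity`
-- (single-problem summit, D-0017), which the `dupNamespace` linter flags on every declaration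
set_option linter.dupNamespace false

noncomputable section

namespace Summit.HubbardSuperconductivity.HubbardSuperconductivity.Theorems.LiebTwinFlip

open Matrix Literature.MathematicalPhysics.QuantumLattice Literature.Probability.LatticeModels
open Summit.HubbardSuperconductivity.HubbardSuperconductivity.Theorems.NodalDiracTwist
open scoped ComplexOrder

/-! ### The spin exchange as an involution of the orbitals -/

section SpinSwap

variable {Λ : Type*} [LinearOrder Λ] [Fintype Λ]

omit [LinearOrder Λ] [Fintype Λ] in
/-- The spin exchange is its own inverse (tree: `NodalDiracTwist.spinSwap_spinSwap`). [folklore] -/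
theorem spinSwap_symm : (Orb.spinSwap : Orb Λ ≃ Orb Λ).symm = Orb.spinSwap := by
  ext i
  rw [Equiv.symm_apply_eq, spinSwap_spinSwap]

/-- The spin exchange maps the two-species configuration `α↑ ∪ β↓` to `β↑ ∪ α↓`. [folklore] -/
theorem finsetCongr_spinSwap_pairSet (α β : Finset Λ) :
    (Orb.spinSwap : Orb Λ ≃ Orb Λ).finsetCongr (pairSet α β) = pairSet β α := by
  ext i
  rw [Equiv.finsetCongr_apply, Finset.mem_map_equiv, spinSwap_symm]
  rcases orb_cases i with h | h <;> rw [h, Orb.spinSwap_orb] <;> simp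

/-! ### The sign identity `ε_F(α↑ ∪ β↓) σ(α,β) σ(β,α) = (-1)^{|α||β|}` -/

omit [Fintype Λ] in
/-- Two up orbitals are never inverted by the spin exchange. [folklore] -/
theorem invWeight_spinSwap_orb_zero_zero (a a' : Λ) :
    invWeight (Orb.spinSwap : Orb Λ ≃ Orb Λ) (orb a 0) (orb a' 0) = 1 := by
  simp only [invWeight, Orb.spinSwap_orb, Equiv.swap_apply_left, orb_lt_orb_zero_iff,
    orb_lt_orb_one_iff, one_ne_zero, and_false, or_false]
  rw [if_neg]
  rintro ⟨h1, h2⟩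
  exact lt_asymm h1 h2

omit [Fintype Λ] in
/-- Two down orbitals are never inverted by the spin exchange. [folklore] -/
theorem invWeight_spinSwap_orb_one_one (b b' : Λ) :
    invWeight (Orb.spinSwap : Orb Λ ≃ Orb Λ) (orb b 1) (orb b' 1) = 1 := by
  simp only [invWeight, Orb.spinSwap_orb, Equiv.swap_apply_right, orb_lt_orb_zero_iff,
    orb_lt_orb_one_iff, one_ne_zero, and_false, or_false]
  rw [if_neg]
  rintro ⟨h1, h2⟩
  exact lt_asymm h1 h2

omit [Fintype Λ] in
/-- A down orbital below an up orbital is not inverted by the spin exchange. [folklore] -/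
theorem invWeight_spinSwap_orb_one_zero (b a : Λ) :
    invWeight (Orb.spinSwap : Orb Λ ≃ Orb Λ) (orb b 1) (orb a 0) = 1 := by
  simp only [invWeight, Orb.spinSwap_orb, Equiv.swap_apply_left, Equiv.swap_apply_right,
    orb_lt_orb_zero_iff]
  rw [if_neg]
  rintro ⟨h1, h2⟩
  exact lt_asymm h1 h2

omit [Fintype Λ] in
/-- An up orbital `a↑` and a later down orbital `b↓` are inverted by the spin exchange exactly when
they sit on the same site (`a↑ < a↓` becomes `a↓ > a↑`): the relabelling sign of the spin exchange
counts the doubly occupied sites. [folklore] -/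
theorem invWeight_spinSwap_orb_zero_one (a b : Λ) :
    invWeight (Orb.spinSwap : Orb Λ ≃ Orb Λ) (orb a 0) (orb b 1) = if a = b then -1 else 1 := by
  simp only [invWeight, Orb.spinSwap_orb, Equiv.swap_apply_left, Equiv.swap_apply_right,
    orb_lt_orb_one_iff, and_true]
  rcases lt_trichotomy a b with hab | rfl | hab
  · rw [if_neg, if_neg hab.ne]
    rintro ⟨-, h | h⟩
    · exact lt_asymm hab h
    · exact hab.ne' h
  · simp
  · rw [if_neg, if_neg hab.ne']
    rintro ⟨h | h, -⟩
    · exact lt_asymm hab h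
    · exact hab.ne' h

/-- **The sign identity of the spin exchange in Lieb's coordinates**:
`ε_F(α↑ ∪ β↓) · σ(α, β) · σ(β, α) = (-1)^{|α||β|}`, where `ε_F = relabelSign Orb.spinSwap` is the
relabelling sign (it counts the doubly occupied sites `|α ∩ β|`) and `σ = pairSign` is Lieb's sign
(`σ(α,β)σ(β,α)` counts the pairs `(a, b) ∈ α × β` with `a ≠ b`). Split the double product of pair weights
over `(α↑ ∪ β↓)²` into its four spin blocks: the diagonal blocks and the `↓↑` block are trivial, and in
the `↑↓` block each pair `(a, b)` contributes `-1` from exactly one of `a = b`, `b < a`, `a < b`.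
Lieb, PRL 62 (1989) 1201, proof of Theorem 1; Tasaki (2020) §9.2.1. [folklore] -/
theorem relabelSign_spinSwap_pairSet_mul (α β : Finset Λ) :
    relabelSign (Orb.spinSwap : Orb Λ ≃ Orb Λ) (pairSet α β) * (pairSign α β * pairSign β α) =
      (-1) ^ (α.card * β.card) := by
  -- the two embedded copies `α↑`, `β↓`
  set u : Λ ↪ Orb Λ := ⟨fun x => orb x 0, fun x y h => by simpa using congrArg (fun i => (ofLex i).1) h⟩
    with hu
  set d : Λ ↪ Orb Λ := ⟨fun x => orb x 1, fun x y h => by simpa using congrArg (fun i => (ofLex i).1) h⟩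
    with hd
  have hS : pairSet α β = α.map u ∪ β.map d := pairSet_eq_union_map α β
  have hdisj : Disjoint (α.map u) (β.map d) := by
    rw [Finset.disjoint_left]
    intro i hi hi'
    simp only [Finset.mem_map] at hi hi'
    obtain ⟨x, -, rfl⟩ := hi
    obtain ⟨y, -, hy⟩ := hi'
    simpa [hu, hd] using congrArg (fun i => (ofLex i).2) hy
  set F := (Orb.spinSwap : Orb Λ ≃ Orb Λ) with hF
  -- split the double product over `S × S` into the four blocks
  rw [relabelSign_eq_prod, hS, Finset.prod_union hdisj]
  have hsplit : ∀ j, ∏ k ∈ α.map u ∪ β.map d, invWeight F j k =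
      (∏ a ∈ α, invWeight F j (orb a 0)) * ∏ b ∈ β, invWeight F j (orb b 1) := by
    intro j
    rw [Finset.prod_union hdisj, Finset.prod_map, Finset.prod_map]
    rfl
  simp only [hsplit, Finset.prod_mul_distrib, Finset.prod_map]
  -- evaluate the four blocks
  have hAA : ∏ a ∈ α, ∏ a' ∈ α, invWeight F (u a) (orb a' 0) = 1 :=
    Finset.prod_eq_one fun a _ => Finset.prod_eq_one fun a' _ => invWeight_spinSwap_orb_zero_zero a a'
  have hBB : ∏ b ∈ β, ∏ b' ∈ β, invWeight F (d b) (orb b' 1) = 1 :=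
    Finset.prod_eq_one fun b _ => Finset.prod_eq_one fun b' _ => invWeight_spinSwap_orb_one_one b b'
  have hBA : ∏ b ∈ β, ∏ a ∈ α, invWeight F (d b) (orb a 0) = 1 :=
    Finset.prod_eq_one fun b _ => Finset.prod_eq_one fun a _ => invWeight_spinSwap_orb_one_zero b a
  have hAB : ∏ a ∈ α, ∏ b ∈ β, invWeight F (u a) (orb b 1) =
      ∏ a ∈ α, ∏ b ∈ β, if a = b then (-1 : ℂ) else 1 :=
    Finset.prod_congr rfl fun a _ => Finset.prod_congr rfl fun b _ => invWeight_spinSwap_orb_zero_one a b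
  have hβα : pairSign β α = ∏ a ∈ α, ∏ b ∈ β, if a < b then (-1 : ℂ) else 1 := by
    rw [pairSign_eq_prod_prod_ite, Finset.prod_comm]
  rw [hAA, hBB, hBA, hAB, pairSign_eq_prod_prod_ite, hβα, one_mul, mul_one, mul_one,
    ← Finset.prod_mul_distrib, ← Finset.prod_mul_distrib]
  -- pointwise: exactly one of `a = b`, `b < a`, `a < b` holds
  have hpt : ∀ a b : Λ, (if a = b then (-1 : ℂ) else 1) *
      ((if b < a then (-1 : ℂ) else 1) * (if a < b then (-1 : ℂ) else 1)) = -1 := by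
    intro a b
    rcases lt_trichotomy a b with hab | rfl | hab
    · rw [if_neg hab.ne, if_neg (lt_asymm hab), if_pos hab]; norm_num
    · simp
    · rw [if_neg hab.ne', if_pos hab, if_neg (lt_asymm hab)]; norm_num
  calc ∏ a ∈ α, ((∏ b ∈ β, if a = b then (-1 : ℂ) else 1) *
          ((∏ b ∈ β, if b < a then (-1 : ℂ) else 1) * ∏ b ∈ β, if a < b then (-1 : ℂ) else 1))
      = ∏ a ∈ α, ∏ _b ∈ β, (-1 : ℂ) := by
        refine Finset.prod_congr rfl fun a _ => ?_
        rw [← Finset.prod_mul_distrib, ← Finset.prod_mul_distrib]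
        exact Finset.prod_congr rfl fun b _ => hpt a b
    _ = (-1) ^ (α.card * β.card) := by
        rw [Finset.prod_const, Finset.prod_const, ← pow_mul, mul_comm]

/-! ### The spin exchange in Lieb's coordinates is the transpose -/

/-- **`W(F χ) = (-1)^{n²} W(χ)ᵀ`**: on Lieb's coefficient matrices of the `(n, n)` sector the spin-flip
unitary `F = fockRelabel Orb.spinSwap` acts as the TRANSPOSE, up to the uniform sign `(-1)^{n²}`
("the Hamiltonian is symmetric between the up and the down spins"; the sign is
`ε_F(β↑ ∪ α↓) σ(α,β) σ(β,α)`, `relabelSign_spinSwap_pairSet_mul`). Lieb, PRL 62 (1989) 1201, proof of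
Theorem 1. [folklore] -/
theorem liebW_fockRelabel_spinSwap_mulVec (n : ℕ) (χ : Fock (Orb Λ)) :
    liebW n ((fockRelabel (Orb.spinSwap : Orb Λ ≃ Orb Λ)).val *ᵥ χ) =
      ((-1 : ℂ) ^ (n * n)) • (liebW n χ)ᵀ := by
  ext α β
  rw [liebW_apply, fockRelabel_mulVec_apply, Matrix.smul_apply, transpose_apply, liebW_apply,
    smul_eq_mul]
  have h1 : (Orb.spinSwap : Orb Λ ≃ Orb Λ).finsetCongr.symm (pairSet α.1 β.1) = pairSet β.1 α.1 := by
    rw [Equiv.symm_apply_eq]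
    exact (finsetCongr_spinSwap_pairSet β.1 α.1).symm
  rw [h1]
  have key := relabelSign_spinSwap_pairSet_mul β.1 α.1
  rw [β.2, α.2] at key
  have hsq := LiebThm1.pairSign_mul_self β.1 α.1
  linear_combination (pairSign β.1 α.1 * χ (pairSet β.1 α.1)) * key -
    (pairSign α.1 β.1 * relabelSign (Orb.spinSwap : Orb Λ ≃ Orb Λ) (pairSet β.1 α.1) *
      χ (pairSet β.1 α.1)) * hsq

end SpinSwap

/-! ### The spin-flip unitary `F = fockRelabel Orb.spinSwap` on vectors -/

section FockFlip

variable {Λ : Type*} [LinearOrder Λ] [Fintype Λ]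

/-- `F` is a REAL matrix: it commutes with entrywise complex conjugation of vectors,
`star (F χ) = F (star χ)` (its entries are the signs `ε_F(t) = ±1`). [folklore] -/
theorem star_fockRelabel_spinSwap_mulVec (χ : Fock (Orb Λ)) :
    star ((fockRelabel (Orb.spinSwap : Orb Λ ≃ Orb Λ)).val *ᵥ χ) =
      (fockRelabel (Orb.spinSwap : Orb Λ ≃ Orb Λ)).val *ᵥ star χ := by
  rw [star_mulVec_eq_map_star_mulVec, fockRelabel_map_star]

/-- `F² = 1` on vectors (tree: `NodalDiracTwist.fockRelabel_spinSwap_mul_self`). [folklore] -/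
theorem fockRelabel_spinSwap_mulVec_mulVec (χ : Fock (Orb Λ)) :
    (fockRelabel (Orb.spinSwap : Orb Λ ≃ Orb Λ)).val *ᵥ
        ((fockRelabel (Orb.spinSwap : Orb Λ ≃ Orb Λ)).val *ᵥ χ) = χ := by
  rw [mulVec_mulVec, fockRelabel_spinSwap_mul_self, one_mulVec]

/-- **Cross terms between the `±1` eigenvectors of `F` vanish** for every operator `A` invariant under
the spin exchange: if `F p = p` and `F m = -m` then `⟨p, A m⟩ = 0` (`F` is unitary and commutes with
`A`, so `⟨p, A m⟩ = ⟨F p, A F m⟩ = -⟨p, A m⟩`). [folklore] -/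
theorem star_dotProduct_mulVec_eq_zero_of_flip {A : Matrix (Finset (Orb Λ)) (Finset (Orb Λ)) ℂ}
    (hA : relabel (Orb.spinSwap : Orb Λ ≃ Orb Λ) A = A) {p m : Fock (Orb Λ)}
    (hp : (fockRelabel (Orb.spinSwap : Orb Λ ≃ Orb Λ)).val *ᵥ p = p)
    (hm : (fockRelabel (Orb.spinSwap : Orb Λ ≃ Orb Λ)).val *ᵥ m = -m) :
    star p ⬝ᵥ (A *ᵥ m) = 0 := by
  have hc := fockRelabel_commute_of_relabel_eq (Orb.spinSwap : Orb Λ ≃ Orb Λ) hA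
  have h := star_fockRelabel_mulVec_dotProduct_fockRelabel_mulVec
    (Orb.spinSwap : Equiv.Perm (Orb Λ)) p (A *ᵥ m)
  rw [hp, mulVec_mulVec, hc.eq, ← mulVec_mulVec, hm, mulVec_neg, dotProduct_neg] at h
  linear_combination -(1 / 2 : ℂ) * h

/-- **Additivity of an `F`-invariant quadratic form over the `F`-eigen-decomposition**: for `A`
invariant under the spin exchange, `F p = p`, `F m = -m`: `⟨p + m, A (p + m)⟩ = ⟨p, A p⟩ + ⟨m, A m⟩`.
[folklore] -/
theorem expect_add_of_flip {A : Matrix (Finset (Orb Λ)) (Finset (Orb Λ)) ℂ}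
    (hA : relabel (Orb.spinSwap : Orb Λ ≃ Orb Λ) A = A) {p m : Fock (Orb Λ)}
    (hp : (fockRelabel (Orb.spinSwap : Orb Λ ≃ Orb Λ)).val *ᵥ p = p)
    (hm : (fockRelabel (Orb.spinSwap : Orb Λ ≃ Orb Λ)).val *ᵥ m = -m) :
    expect A (p + m) = expect A p + expect A m := by
  have h1 := star_dotProduct_mulVec_eq_zero_of_flip hA hp hm
  -- the other cross term: apply the first to `A`, `p' = p`, `m' = m` read through `⟨m, A p⟩ = ⟨F m, A F p⟩`
  have hc := fockRelabel_commute_of_relabel_eq (Orb.spinSwap : Orb Λ ≃ Orb Λ) hA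
  have h2 : star m ⬝ᵥ (A *ᵥ p) = 0 := by
    have h := star_fockRelabel_mulVec_dotProduct_fockRelabel_mulVec
      (Orb.spinSwap : Equiv.Perm (Orb Λ)) m (A *ᵥ p)
    rw [hm, mulVec_mulVec, hc.eq, ← mulVec_mulVec, hp, star_neg, neg_dotProduct] at h
    linear_combination -(1 / 2 : ℂ) * h
  simp only [expect, mulVec_add, star_add, add_dotProduct, dotProduct_add, h1, h2]
  ring

/-- Eigenvectors of the unitary `F` for the eigenvalues `+1` and `-1` are orthogonal. [folklore] -/
theorem star_dotProduct_eq_zero_of_flip {p m : Fock (Orb Λ)}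
    (hp : (fockRelabel (Orb.spinSwap : Orb Λ ≃ Orb Λ)).val *ᵥ p = p)
    (hm : (fockRelabel (Orb.spinSwap : Orb Λ ≃ Orb Λ)).val *ᵥ m = -m) :
    star p ⬝ᵥ m = 0 := by
  have h := star_fockRelabel_mulVec_dotProduct_fockRelabel_mulVec (Orb.spinSwap : Equiv.Perm (Orb Λ)) p m
  rw [hp, hm, dotProduct_neg] at h
  linear_combination -(1 / 2 : ℂ) * h

/-- **Additivity of the norm over the `F`-eigen-decomposition**: `‖p + m‖² = ‖p‖² + ‖m‖²` for `F p = p`,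
`F m = -m`. [folklore] -/
theorem star_add_dotProduct_add_of_flip {p m : Fock (Orb Λ)}
    (hp : (fockRelabel (Orb.spinSwap : Orb Λ ≃ Orb Λ)).val *ᵥ p = p)
    (hm : (fockRelabel (Orb.spinSwap : Orb Λ ≃ Orb Λ)).val *ᵥ m = -m) :
    star (p + m) ⬝ᵥ (p + m) = star p ⬝ᵥ p + star m ⬝ᵥ m := by
  have h1 := star_dotProduct_eq_zero_of_flip hp hm
  have h2 : star m ⬝ᵥ p = 0 := by
    have h := star_fockRelabel_mulVec_dotProduct_fockRelabel_mulVec (Orb.spinSwap : Equiv.Perm (Orb Λ)) m p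
    rw [hp, hm, star_neg, neg_dotProduct] at h
    linear_combination -(1 / 2 : ℂ) * h
  rw [star_add, add_dotProduct, dotProduct_add, dotProduct_add, h1, h2, add_zero, zero_add]

/-- **Additivity of a real quadratic form over real and imaginary parts**: for a REAL matrix `Δ`
(`Δ̄ = Δ` entrywise) and REAL vectors `u, v`: `‖Δ(u + iv)‖² = ‖Δu‖² + ‖Δv‖²`, i.e.
`⟨u + iv, ΔᴴΔ (u + iv)⟩ = ⟨u, ΔᴴΔ u⟩ + ⟨v, ΔᴴΔ v⟩` (the cross term `⟨Δu, Δv⟩` is real and symmetric).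
Tasaki (2020) §2.1. [folklore] -/
theorem expect_conjTranspose_mul_add_I_smul {ι : Type*} [Fintype ι]
    (Δ : Matrix (Finset ι) (Finset ι) ℂ) (hΔ : Δ.map star = Δ) {u v : Fock ι}
    (hu : star u = u) (hv : star v = v) :
    expect (Δᴴ * Δ) (u + Complex.I • v) = expect (Δᴴ * Δ) u + expect (Δᴴ * Δ) v := by
  rw [PosSemidefTrace.expect_conjTranspose_mul, PosSemidefTrace.expect_conjTranspose_mul,
    PosSemidefTrace.expect_conjTranspose_mul]
  have ha : star (Δ *ᵥ u) = Δ *ᵥ u := by rw [star_mulVec_eq_map_star_mulVec, hΔ, hu]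
  have hb : star (Δ *ᵥ v) = Δ *ᵥ v := by rw [star_mulVec_eq_map_star_mulVec, hΔ, hv]
  have hcomm : (Δ *ᵥ v) ⬝ᵥ (Δ *ᵥ u) = (Δ *ᵥ u) ⬝ᵥ (Δ *ᵥ v) := dotProduct_comm _ _
  rw [mulVec_add, mulVec_smul, star_add, star_smul, ha, hb, Complex.star_def, Complex.conj_I,
    add_dotProduct, dotProduct_add, dotProduct_add, smul_dotProduct, smul_dotProduct, dotProduct_smul,
    dotProduct_smul, smul_eq_mul, smul_eq_mul, smul_eq_mul, smul_eq_mul]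
  linear_combination (-Complex.I) * hcomm - ((Δ *ᵥ v) ⬝ᵥ (Δ *ᵥ v)) * Complex.I_mul_I

/-- The norm version: for real vectors `u, v`, `‖u + iv‖² = ‖u‖² + ‖v‖²`. [folklore] -/
theorem star_add_I_smul_dotProduct {ι : Type*} [Fintype ι] {u v : ι → ℂ}
    (hu : star u = u) (hv : star v = v) :
    star (u + Complex.I • v) ⬝ᵥ (u + Complex.I • v) = star u ⬝ᵥ u + star v ⬝ᵥ v := by
  have hcomm : v ⬝ᵥ u = u ⬝ᵥ v := dotProduct_comm _ _
  rw [star_add, star_smul, hu, hv, Complex.star_def, Complex.conj_I, add_dotProduct, dotProduct_add,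
    dotProduct_add, smul_dotProduct, smul_dotProduct, dotProduct_smul, dotProduct_smul, smul_eq_mul,
    smul_eq_mul, smul_eq_mul, smul_eq_mul]
  linear_combination (-Complex.I) * hcomm - (v ⬝ᵥ v) * Complex.I_mul_I

/-- `⟨c • ψ, A (c • ψ)⟩ = c̄ c ⟨ψ, A ψ⟩`. [folklore] -/
theorem expect_smul {ι : Type*} [Fintype ι] (A : Matrix (Finset ι) (Finset ι) ℂ) (c : ℂ) (ψ : Fock ι) :
    expect A (c • ψ) = star c * c * expect A ψ := by
  rw [expect, expect, mulVec_smul, star_smul, smul_dotProduct, dotProduct_smul, smul_eq_mul, smul_eq_mul,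
    mul_assoc]

/-- `⟨ψ, ψ⟩` is real: `⟨ψ, ψ⟩ = re⟨ψ, ψ⟩`. [folklore] -/
theorem star_dotProduct_self_eq_ofReal_re {ι : Type*} [Fintype ι] (ψ : ι → ℂ) :
    star ψ ⬝ᵥ ψ = (((star ψ ⬝ᵥ ψ).re : ℝ) : ℂ) := by
  have h : (starRingEnd ℂ) (star ψ ⬝ᵥ ψ) = star ψ ⬝ᵥ ψ := by
    rw [← Complex.star_def, ← star_dotProduct]
  exact (Complex.conj_eq_iff_re.1 h).symm

end FockFlip

end Summit.HubbardSuperconductivity.HubbardSuperconductivity.Theorems.LiebTwinFlip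

end
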